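import Literature.NumberTheory.Rogawski1990.ArchSingularCurveNormPair        -- ★ p839172 (B-p12): the lifted singular curve `(γH, γG)`, `evalC_archGammaTwo_archSingularCurveH`, §4 heads
import Mathlib.Analysis.InnerProductSpace.Calculus                           -- `DifferentiableAt.norm`
import Mathlib.Analysis.SpecialFunctions.Complex.Circle
import HarnessLib

/-!
# Differentiability in `ψ` of Rogawski's archimedean explicit factor along the singular curve `γ(θ, φ, ψ)`: `D_{G∕H,∞}`, `τ`'s argument, and —
# modulo smoothness of `μ_∞` — `τ_∞` and `Δ″_∞` (the transfer-factor half of the (L-jump) letter; Rogawski (1990) §8.2 (8.2.1) p. 123)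

Topic `NumberTheory/Rogawski1990`; namespace `Literature.NumberTheory.Rogawski1990`.  THEOREMS ONLY (no definition, no named fact, no instance, no notation,
no `sorry`; net debt 0).  Cell `pub/hodgecm-mathlib`, F0∕P3a, topic T6 (#88 side; brick «(L-jump)-Δ READINESS», LEAD F0P3a-plan (g8) T7-87 (C)): print
differentiates `ψ ↦ τ(γ)D_G(γ)Φ^κ(γ, f)` at `ψ = 0+` ((8.2.1) p. 123); this file supplies the `ψ`-differentiability of the TRANSFER-FACTOR pieces along
★ B-p12's lifted curve `ArchSingularCurveNormPair` (binders VERBATIM; consumers pass `_ _ rfl rfl`), banked for the floor-2 (L-jump-orbital) letter of D2′.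
Over ★ `ArchSingularCurveNormPair` (p839172) + ★ `ArchEndoscopicTorusCayleyFrame` (p839084) + ★ curve′ `ArchExplicitTransferFactorAlongCurve` (p838769) +
★ p06 `ArchTorusOneAngleCurve` (`hasDerivAt_coe_torusCurve`).  Mathlib-only footing; count-neutral for the books.

THE MATHEMATICS.  At a complex place `w` the curve reads `g_w(ψ) = P·diag(a_w(ψ), b_w(ψ))·P⁻¹`, `a_w(ψ) = z₀,w,0 e^{i c_w ψ}`, `b_w(ψ) = z₀,w,2 e^{−i c_w ψ}`,
`u_w = z₀,w,1` (constant).  Hence `σ_w(χ_{g(ψ)}(u)) = (u_w − a_w(ψ))(u_w − b_w(ψ))`, `σ_w(det g(ψ)) = a_w(ψ) b_w(ψ)`, `σ_w(t(ψ)) = −(u_w − a_w)(u_w − b_w)∕(a_w b_w)`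
for `τ`'s argument `t = −χ_g(u)·det g⁻¹` — all trigonometric polynomials in `ψ`, so differentiable; `D_{G∕H,∞}(γ_H(ψ)) = Π_w |(u_w − a_w(ψ))(u_w − b_w(ψ))|` is
differentiable at `ψ = 0` because every factor is non-zero there (`z₀,w,0 = z₀,w,2 ≠ z₀,w,1`: the pair is `(G,H)`-regular at `γ₀`).  `τ_∞(ψ) = μ_∞(u)·μ_∞(t(ψ))⁻¹`
with `μ_∞(u)` CONSTANT (`u` does not move); its differentiability needs that of `μ_∞ = archHeckeValue μ` along the smooth curve `t(ψ)` in `(L⊗ℝ)ˣ` — true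
(continuous characters of the Lie group `(L ⊗ ℝ)ˣ` are smooth; print p. 123: `μ⁻¹(z) = z|z|⁻¹(z∕z̄)^t`) but NOT in the tree, so it is carried as the honest
binder `hμ`.  Finally `Π_w κ_w` is frozen near `ψ = 0` (★ `eventually_prod_archKappaAt_archSingularCurve_eq`), so `Δ″_∞ = τ_∞·D·Π_wκ_w` is differentiable at
`0` as soon as `τ_∞` is.

* §1 `coe_map_evalC_fst_archSingularCurveH` (the `w`-matrix `½·[[a+b, a−b],[a−b, a+b]]`), **`evalC_eval_archCharpolyTwo_archSingularCurveH`** (`= (u−a)(u−b)`),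
  `evalC_det_fst_archSingularCurveH` (`= ab`), **`evalC_archTauArg_archSingularCurveH`** (`= −(u−a)(u−b)(ab)⁻¹`), `archGammaTwo_archSingularCurveH_eq` (`u` constant).
* §2 `hasDerivAt_coe_splitCoord`, **`differentiableAt_evalC_eval_archCharpolyTwo_archSingularCurveH`**, `differentiableAt_evalC_archTauArg_archSingularCurveH`,
  `evalC_eval_archCharpolyTwo_archSingularCurveH_zero_ne_zero`, **`differentiableAt_archWeylRatio_archSingularCurve`** (unconditional).
* §3 (binder `hμ`) **`differentiableAt_archTau_archSingularCurve_of`**, `eventually_archExplicitDelta_archSingularCurve_eq`,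
  **`differentiableAt_archExplicitDelta_archSingularCurve_of`**.

HONEST LABEL: HC_CM is proved only modulo the printed citations (named inputs remaining 2) until rung 0 closes; this file proves none of them.

## References
* [Rogawski1990] J. D. Rogawski, *Automorphic Representations of Unitary Groups in Three Variables*, Ann. of Math. Stud. 123 (1990): §8.2 pp. 122–123 ((8.2.1), the curve
  `γ(θ,φ,ψ)`, `τ(γ)|A₁A₂|` explicit), §4.9 pp. 54–55, §14.6 p. 242.
* [Shelstad1979] D. Shelstad, *Characters and inner forms of a quasi-split group over `ℝ`*, Compositio Math. 39 (1979), §4.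
-/

set_option autoImplicit false

noncomputable section

open NumberField NumberField.InfinitePlace Matrix Polynomial Filter Topology Complex
open scoped MatrixGroups

namespace Literature.NumberTheory.Rogawski1990

open Literature.NumberTheory.Automorphic
open Literature.NumberTheory.GaloisRepresentations

section Curve

variable (L : Type) [Field L] [NumberField L] [IsCMField L] (α : Fin 3 → L)
  (z₀ : {w : InfinitePlace L // IsComplex w} → Fin 3 → Circle) (c : {w : InfinitePlace L // IsComplex w} → ℝ)
  (γH : ℝ →
    ↥(UnitaryGroup.arch (↥(maximalRealSubfield L)) L (IsCMField.complexConj L) 2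
        (Matrix.of fun i j : Fin 2 => if i.val + j.val + 1 = 2 then (1 : L) else 0)) ×
      ↥(UnitaryGroup.arch (↥(maximalRealSubfield L)) L (IsCMField.complexConj L) 1
        (Matrix.of fun i j : Fin 1 => if i.val + j.val + 1 = 1 then (1 : L) else 0)))
  (γG : ℝ → ↥(UnitaryGroup.arch (↥(maximalRealSubfield L)) L (IsCMField.complexConj L) 3 (Matrix.diagonal α)))
  (hγH : γH = fun ψ =>
    ((UnitaryGroup.archPiEquivCM 2 L (Matrix.of fun i j : Fin 2 => if i.val + j.val + 1 = 2 then (1 : L) else 0)).symm fun w =>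
        ⟨Matrix.GeneralLinearGroup.mkOfDetNeZero !![(1 : ℂ), 1; 1, -1] UnitaryGroup.det_cayleyTwo_ne_zero *
            UnitaryGroup.circleDiagonal 2 ![z₀ w 0 * Circle.exp (![(1 : ℝ), 0, -1] 0 * (c w * ψ)), z₀ w 2 * Circle.exp (![(1 : ℝ), 0, -1] 2 * (c w * ψ))] *
          (Matrix.GeneralLinearGroup.mkOfDetNeZero !![(1 : ℂ), 1; 1, -1] UnitaryGroup.det_cayleyTwo_ne_zero)⁻¹,
          UnitaryGroup.cayley_conj_circleDiagonal_mem_archLocal L w _⟩,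
      (UnitaryGroup.archPiEquivCM 1 L (Matrix.of fun i j : Fin 1 => if i.val + j.val + 1 = 1 then (1 : L) else 0)).symm fun w =>
        ⟨UnitaryGroup.circleDiagonal 1 ![z₀ w 1 * Circle.exp (![(1 : ℝ), 0, -1] 1 * (c w * ψ))],
          UnitaryGroup.circleDiagonal_mem_archLocal_antidiagOne L w _⟩))
  (hγG : γG = fun ψ => UnitaryGroup.archDiagTorus L 3 α fun w i => z₀ w i * Circle.exp (![(1 : ℝ), 0, -1] i * (c w * ψ)))

/-! ## §1 The explicit-factor ingredients at a complex place along the curve -/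

include hγH in
/-- The `w`-matrix of `g(ψ)`: `½·[[a+b, a−b],[a−b, a+b]]` with `a = z₀,w,0 e^{ic_wψ}`, `b = z₀,w,2 e^{−ic_wψ}` (★ `map_evalC_fst_archSingularCurveH` ∘ ★
`coe_cayley_conj_circleDiagonal`). [cite: Rogawski1990, §8.2 p. 122] -/
theorem coe_map_evalC_fst_archSingularCurveH (ψ : ℝ) (w : {w : InfinitePlace L // IsComplex w}) :
    ((((γH ψ).1 : ↥(UnitaryGroup.arch (↥(maximalRealSubfield L)) L (IsCMField.complexConj L) 2
        (Matrix.of fun i j : Fin 2 => if i.val + j.val + 1 = 2 then (1 : L) else 0))) : GL (Fin 2) (mixedEmbedding.mixedSpace L)) :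
          Matrix (Fin 2) (Fin 2) (mixedEmbedding.mixedSpace L)).map (UnitaryGroup.evalC L w) =
      !![(((z₀ w 0 * Circle.exp (![(1 : ℝ), 0, -1] 0 * (c w * ψ)) : Circle) : ℂ) + ((z₀ w 2 * Circle.exp (![(1 : ℝ), 0, -1] 2 * (c w * ψ)) : Circle) : ℂ)) / 2,
          (((z₀ w 0 * Circle.exp (![(1 : ℝ), 0, -1] 0 * (c w * ψ)) : Circle) : ℂ) - ((z₀ w 2 * Circle.exp (![(1 : ℝ), 0, -1] 2 * (c w * ψ)) : Circle) : ℂ)) / 2;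
        (((z₀ w 0 * Circle.exp (![(1 : ℝ), 0, -1] 0 * (c w * ψ)) : Circle) : ℂ) - ((z₀ w 2 * Circle.exp (![(1 : ℝ), 0, -1] 2 * (c w * ψ)) : Circle) : ℂ)) / 2,
          (((z₀ w 0 * Circle.exp (![(1 : ℝ), 0, -1] 0 * (c w * ψ)) : Circle) : ℂ) + ((z₀ w 2 * Circle.exp (![(1 : ℝ), 0, -1] 2 * (c w * ψ)) : Circle) : ℂ)) / 2] := by
  have h := congrArg (fun g : GL (Fin 2) ℂ => (g : Matrix (Fin 2) (Fin 2) ℂ)) (map_evalC_fst_archSingularCurveH L z₀ c γH hγH ψ w)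
  rw [UnitaryGroup.coe_cayley_conj_circleDiagonal] at h
  simp only [Matrix.cons_val_zero, Matrix.cons_val_one] at h
  exact (Eq.trans rfl h : _)

include hγH in
/-- **`σ_w(χ_{g(ψ)}(u)) = (u_w − a_w(ψ))(u_w − b_w(ψ))`** along the curve (`u_w = z₀,w,1`, ★ `evalC_archGammaTwo_archSingularCurveH`). [cite: Rogawski1990, §8.2 pp. 122–123] -/
theorem evalC_eval_archCharpolyTwo_archSingularCurveH (ψ : ℝ) (w : {w : InfinitePlace L // IsComplex w}) :
    UnitaryGroup.evalC L w ((archCharpolyTwo L (γH ψ)).eval (archGammaTwo L (γH ψ))) =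
      ((z₀ w 1 : ℂ) - ((z₀ w 0 * Circle.exp (![(1 : ℝ), 0, -1] 0 * (c w * ψ)) : Circle) : ℂ)) *
        ((z₀ w 1 : ℂ) - ((z₀ w 2 * Circle.exp (![(1 : ℝ), 0, -1] 2 * (c w * ψ)) : Circle) : ℂ)) := by
  rw [← Polynomial.eval₂_at_apply, ← Polynomial.eval_map]
  unfold archCharpolyTwo
  rw [← Matrix.charpoly_map, coe_map_evalC_fst_archSingularCurveH L z₀ c γH hγH ψ w, evalC_archGammaTwo_archSingularCurveH L z₀ c γH hγH ψ w,
    Matrix.charpoly_fin_two]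
  simp only [Matrix.trace_fin_two, Matrix.det_fin_two, Matrix.of_apply, Matrix.cons_val', Matrix.cons_val_zero, Matrix.cons_val_one,
    Matrix.empty_val', Matrix.cons_val_fin_one, eval_add, eval_sub, eval_mul, eval_pow, eval_X, eval_C, map_add, map_sub, map_mul]
  ring

include hγH in
/-- `σ_w(det g(ψ)) = a_w(ψ)·b_w(ψ)`. [cite: Rogawski1990, §8.2 p. 122] -/
theorem evalC_det_fst_archSingularCurveH (ψ : ℝ) (w : {w : InfinitePlace L // IsComplex w}) :
    UnitaryGroup.evalC L w
        ((((γH ψ).1 : ↥(UnitaryGroup.arch (↥(maximalRealSubfield L)) L (IsCMField.complexConj L) 2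
          (Matrix.of fun i j : Fin 2 => if i.val + j.val + 1 = 2 then (1 : L) else 0))) : GL (Fin 2) (mixedEmbedding.mixedSpace L)) :
            Matrix (Fin 2) (Fin 2) (mixedEmbedding.mixedSpace L)).det =
      ((z₀ w 0 * Circle.exp (![(1 : ℝ), 0, -1] 0 * (c w * ψ)) : Circle) : ℂ) * ((z₀ w 2 * Circle.exp (![(1 : ℝ), 0, -1] 2 * (c w * ψ)) : Circle) : ℂ) := by
  rw [RingHom.map_det, RingHom.mapMatrix_apply, coe_map_evalC_fst_archSingularCurveH L z₀ c γH hγH ψ w, Matrix.det_fin_two]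
  simp only [Matrix.of_apply, Matrix.cons_val', Matrix.cons_val_zero, Matrix.cons_val_one, Matrix.empty_val', Matrix.cons_val_fin_one]
  ring

include hγH in
/-- **`σ_w(t(ψ)) = −(u_w − a_w)(u_w − b_w)·(a_w b_w)⁻¹`** for `τ`'s argument `t = −χ_g(u)·det g⁻¹` (★ `archTauArg`). [cite: Rogawski1990, §8.2 p. 123; §4.9 p. 55] -/
theorem evalC_archTauArg_archSingularCurveH (ψ : ℝ) (w : {w : InfinitePlace L // IsComplex w}) :
    UnitaryGroup.evalC L w (archTauArg L (γH ψ)) =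
      -(((z₀ w 1 : ℂ) - ((z₀ w 0 * Circle.exp (![(1 : ℝ), 0, -1] 0 * (c w * ψ)) : Circle) : ℂ)) *
          ((z₀ w 1 : ℂ) - ((z₀ w 2 * Circle.exp (![(1 : ℝ), 0, -1] 2 * (c w * ψ)) : Circle) : ℂ))) *
        (((z₀ w 0 * Circle.exp (![(1 : ℝ), 0, -1] 0 * (c w * ψ)) : Circle) : ℂ) * ((z₀ w 2 * Circle.exp (![(1 : ℝ), 0, -1] 2 * (c w * ψ)) : Circle) : ℂ))⁻¹ := by
  unfold archTauArg
  rw [map_mul, map_neg, evalC_eval_archCharpolyTwo_archSingularCurveH L z₀ c γH hγH ψ w]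
  congr 1
  -- `σ_w(det g⁻¹) = (σ_w(det g))⁻¹`
  have hdet : (((((γH ψ).1 : ↥(UnitaryGroup.arch (↥(maximalRealSubfield L)) L (IsCMField.complexConj L) 2
          (Matrix.of fun i j : Fin 2 => if i.val + j.val + 1 = 2 then (1 : L) else 0))) : GL (Fin 2) (mixedEmbedding.mixedSpace L))⁻¹ :
            GL (Fin 2) (mixedEmbedding.mixedSpace L)) : Matrix (Fin 2) (Fin 2) (mixedEmbedding.mixedSpace L)).det *
      ((((γH ψ).1 : ↥(UnitaryGroup.arch (↥(maximalRealSubfield L)) L (IsCMField.complexConj L) 2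
          (Matrix.of fun i j : Fin 2 => if i.val + j.val + 1 = 2 then (1 : L) else 0))) : GL (Fin 2) (mixedEmbedding.mixedSpace L)) :
            Matrix (Fin 2) (Fin 2) (mixedEmbedding.mixedSpace L)).det = 1 := by
    rw [← Matrix.det_mul, ← Units.val_mul, inv_mul_cancel, Units.val_one, Matrix.det_one]
  have h1 := congrArg (UnitaryGroup.evalC L w) hdet
  rw [map_mul, map_one, evalC_det_fst_archSingularCurveH L z₀ c γH hγH ψ w] at h1
  exact eq_inv_of_mul_eq_one_left h1

include hγH in
/-- `u` does not move along the curve: `archGammaTwo (γ_H(ψ)) = archGammaTwo (γ_H(0))` (all complex coordinates equal `z₀,w,1`; a CM field has no real place).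
[cite: Rogawski1990, §8.2 p. 122] -/
theorem archGammaTwo_archSingularCurveH_eq (ψ : ℝ) : archGammaTwo L (γH ψ) = archGammaTwo L (γH 0) :=
  UnitaryGroup.mixedSpace_ext (↥(maximalRealSubfield L)) L (IsCMField.complexConj L) (IsCMField.complexConj_ne_one L)
    (UnitaryGroup.complexConj_smul_infinitePlace L) fun w => by
      rw [← UnitaryGroup.evalC_apply, ← UnitaryGroup.evalC_apply, evalC_archGammaTwo_archSingularCurveH L z₀ c γH hγH ψ w,
        evalC_archGammaTwo_archSingularCurveH L z₀ c γH hγH 0 w]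

/-! ## §2 Differentiability in `ψ` of the per-place ingredients and of `D_{G∕H,∞}` -/

omit [NumberField L] [IsCMField L] in
/-- The circle coordinates `ψ ↦ z₀,w,i · e^{i r c_w ψ}` are differentiable (★ p06 `hasDerivAt_coe_torusCurve`). [cite: Rogawski1990, §8.2 p. 123] -/
theorem differentiableAt_coe_splitCoord (w : {w : InfinitePlace L // IsComplex w}) (i : Fin 3) (ψ : ℝ) :
    DifferentiableAt ℝ (fun ψ : ℝ => ((z₀ w i * Circle.exp (![(1 : ℝ), 0, -1] i * (c w * ψ)) : Circle) : ℂ)) ψ := by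
  have h := (hasDerivAt_coe_torusCurve (z₀ w) (fun j => ![(1 : ℝ), 0, -1] j * c w) i ψ).differentiableAt
  simp only [mul_assoc] at h
  exact h

include hγH in
/-- **`ψ ↦ σ_w(χ_{g(ψ)}(u))` is differentiable.** [cite: Rogawski1990, §8.2 p. 123] -/
theorem differentiableAt_evalC_eval_archCharpolyTwo_archSingularCurveH (w : {w : InfinitePlace L // IsComplex w}) (ψ : ℝ) :
    DifferentiableAt ℝ (fun ψ => UnitaryGroup.evalC L w ((archCharpolyTwo L (γH ψ)).eval (archGammaTwo L (γH ψ)))) ψ := by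
  have hfun : (fun ψ => UnitaryGroup.evalC L w ((archCharpolyTwo L (γH ψ)).eval (archGammaTwo L (γH ψ)))) =
      fun ψ => ((z₀ w 1 : ℂ) - ((z₀ w 0 * Circle.exp (![(1 : ℝ), 0, -1] 0 * (c w * ψ)) : Circle) : ℂ)) *
        ((z₀ w 1 : ℂ) - ((z₀ w 2 * Circle.exp (![(1 : ℝ), 0, -1] 2 * (c w * ψ)) : Circle) : ℂ)) :=
    funext fun ψ => evalC_eval_archCharpolyTwo_archSingularCurveH L z₀ c γH hγH ψ w
  rw [hfun]
  exact ((differentiableAt_const _).sub (differentiableAt_coe_splitCoord L z₀ c w 0 ψ)).mul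
    ((differentiableAt_const _).sub (differentiableAt_coe_splitCoord L z₀ c w 2 ψ))

include hγH in
/-- **`ψ ↦ σ_w(t(ψ))` is differentiable** (`a_w b_w ≠ 0` on the circle). [cite: Rogawski1990, §8.2 p. 123] -/
theorem differentiableAt_evalC_archTauArg_archSingularCurveH (w : {w : InfinitePlace L // IsComplex w}) (ψ : ℝ) :
    DifferentiableAt ℝ (fun ψ => UnitaryGroup.evalC L w (archTauArg L (γH ψ))) ψ := by
  have hfun : (fun ψ => UnitaryGroup.evalC L w (archTauArg L (γH ψ))) =
      fun ψ => -(((z₀ w 1 : ℂ) - ((z₀ w 0 * Circle.exp (![(1 : ℝ), 0, -1] 0 * (c w * ψ)) : Circle) : ℂ)) *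
          ((z₀ w 1 : ℂ) - ((z₀ w 2 * Circle.exp (![(1 : ℝ), 0, -1] 2 * (c w * ψ)) : Circle) : ℂ))) *
        (((z₀ w 0 * Circle.exp (![(1 : ℝ), 0, -1] 0 * (c w * ψ)) : Circle) : ℂ) * ((z₀ w 2 * Circle.exp (![(1 : ℝ), 0, -1] 2 * (c w * ψ)) : Circle) : ℂ))⁻¹ :=
    funext fun ψ => evalC_archTauArg_archSingularCurveH L z₀ c γH hγH ψ w
  rw [hfun]
  refine ((((differentiableAt_const _).sub (differentiableAt_coe_splitCoord L z₀ c w 0 ψ)).mul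
    ((differentiableAt_const _).sub (differentiableAt_coe_splitCoord L z₀ c w 2 ψ))).neg).mul ?_
  exact ((differentiableAt_coe_splitCoord L z₀ c w 0 ψ).mul (differentiableAt_coe_splitCoord L z₀ c w 2 ψ)).inv
    (mul_ne_zero (Circle.coe_ne_zero _) (Circle.coe_ne_zero _))

include hγH in
/-- At `ψ = 0` every factor of `D_{G∕H,∞}` is non-zero: `(u_w − z₀,w,0)(u_w − z₀,w,2) ≠ 0` (`z₀,w,0 = z₀,w,2 ≠ z₀,w,1`: `(G,H)`-regularity at `γ₀`).
[cite: Rogawski1990, §8.2 p. 122] -/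
theorem evalC_eval_archCharpolyTwo_archSingularCurveH_zero_ne_zero (h02 : ∀ w, z₀ w 0 = z₀ w 2) (h01 : ∀ w, z₀ w 0 ≠ z₀ w 1)
    (w : {w : InfinitePlace L // IsComplex w}) :
    UnitaryGroup.evalC L w ((archCharpolyTwo L (γH 0)).eval (archGammaTwo L (γH 0))) ≠ 0 := by
  rw [evalC_eval_archCharpolyTwo_archSingularCurveH L z₀ c γH hγH 0 w]
  simp only [mul_zero, Circle.exp_zero, mul_one]
  rw [← h02 w]
  have h : (z₀ w 1 : ℂ) - (z₀ w 0 : ℂ) ≠ 0 := sub_ne_zero.2 fun h => h01 w (Circle.ext h).symm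
  exact mul_ne_zero h h

include hγH in
open scoped Classical in
/-- **`ψ ↦ D_{G∕H,∞}(γ_H(ψ))` IS DIFFERENTIABLE AT `ψ = 0`** along the lifted singular curve — unconditionally (`D = Π_w |(u_w − a_w)(u_w − b_w)|`, every factor
non-zero at `0`, `‖·‖` smooth off `0`). [cite: Rogawski1990, §8.2 (8.2.1) p. 123; §4.9 p. 55] -/
theorem differentiableAt_archWeylRatio_archSingularCurve (h02 : ∀ w, z₀ w 0 = z₀ w 2) (h01 : ∀ w, z₀ w 0 ≠ z₀ w 1) :
    DifferentiableAt ℝ (fun ψ => archWeylRatio L (γH ψ)) 0 := by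
  have hfun : (fun ψ => archWeylRatio L (γH ψ)) =
      fun ψ => ∏ w : {w : InfinitePlace L // IsComplex w}, ‖UnitaryGroup.evalC L w ((archCharpolyTwo L (γH ψ)).eval (archGammaTwo L (γH ψ)))‖ := by
    funext ψ; rfl
  rw [hfun]
  have hf : ∀ w ∈ (Finset.univ : Finset {w : InfinitePlace L // IsComplex w}),
      HasDerivAt (fun ψ => ‖UnitaryGroup.evalC L w ((archCharpolyTwo L (γH ψ)).eval (archGammaTwo L (γH ψ)))‖)
        (deriv (fun ψ => ‖UnitaryGroup.evalC L w ((archCharpolyTwo L (γH ψ)).eval (archGammaTwo L (γH ψ)))‖) 0) 0 :=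
    fun w _ => ((differentiableAt_evalC_eval_archCharpolyTwo_archSingularCurveH L z₀ c γH hγH w 0).norm ℝ
      (evalC_eval_archCharpolyTwo_archSingularCurveH_zero_ne_zero L z₀ c γH hγH h02 h01 w)).hasDerivAt
  exact (HasDerivAt.fun_finsetProd hf).differentiableAt

end Curve

/-! ## §3 `τ_∞` and `Δ″_∞` along the curve, modulo smoothness of `μ_∞` -/

section Tau

variable (L : Type) [Field L] [NumberField L] [IsCMField L] (α : Fin 3 → L)
  (z₀ : {w : InfinitePlace L // IsComplex w} → Fin 3 → Circle) (c : {w : InfinitePlace L // IsComplex w} → ℝ)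
  (γH : ℝ →
    ↥(UnitaryGroup.arch (↥(maximalRealSubfield L)) L (IsCMField.complexConj L) 2
        (Matrix.of fun i j : Fin 2 => if i.val + j.val + 1 = 2 then (1 : L) else 0)) ×
      ↥(UnitaryGroup.arch (↥(maximalRealSubfield L)) L (IsCMField.complexConj L) 1
        (Matrix.of fun i j : Fin 1 => if i.val + j.val + 1 = 1 then (1 : L) else 0)))
  (γG : ℝ → ↥(UnitaryGroup.arch (↥(maximalRealSubfield L)) L (IsCMField.complexConj L) 3 (Matrix.diagonal α)))
  (hγH : γH = fun ψ =>
    ((UnitaryGroup.archPiEquivCM 2 L (Matrix.of fun i j : Fin 2 => if i.val + j.val + 1 = 2 then (1 : L) else 0)).symm fun w =>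
        ⟨Matrix.GeneralLinearGroup.mkOfDetNeZero !![(1 : ℂ), 1; 1, -1] UnitaryGroup.det_cayleyTwo_ne_zero *
            UnitaryGroup.circleDiagonal 2 ![z₀ w 0 * Circle.exp (![(1 : ℝ), 0, -1] 0 * (c w * ψ)), z₀ w 2 * Circle.exp (![(1 : ℝ), 0, -1] 2 * (c w * ψ))] *
          (Matrix.GeneralLinearGroup.mkOfDetNeZero !![(1 : ℂ), 1; 1, -1] UnitaryGroup.det_cayleyTwo_ne_zero)⁻¹,
          UnitaryGroup.cayley_conj_circleDiagonal_mem_archLocal L w _⟩,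
      (UnitaryGroup.archPiEquivCM 1 L (Matrix.of fun i j : Fin 1 => if i.val + j.val + 1 = 1 then (1 : L) else 0)).symm fun w =>
        ⟨UnitaryGroup.circleDiagonal 1 ![z₀ w 1 * Circle.exp (![(1 : ℝ), 0, -1] 1 * (c w * ψ))],
          UnitaryGroup.circleDiagonal_mem_archLocal_antidiagOne L w _⟩))
  (hγG : γG = fun ψ => UnitaryGroup.archDiagTorus L 3 α fun w i => z₀ w i * Circle.exp (![(1 : ℝ), 0, -1] i * (c w * ψ)))
  (h02 : ∀ w, z₀ w 0 = z₀ w 2) (h01 : ∀ w, z₀ w 0 ≠ z₀ w 1)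
  (μ : HeckeCharacter L) (hherm : ((Matrix.diagonal α).map (cmConjRingHom L)).transpose = Matrix.diagonal α)
  (hanis : ∀ x : Fin 3 → L, Literature.AlgebraicGeometry.ShimuraVarieties.hermForm (cmConjRingHom L) (Matrix.diagonal α) x x = 0 → x = 0)

include hγH h02 h01 in
/-- **`ψ ↦ τ_∞(γ_H(ψ))` is differentiable at `0` PROVIDED `ψ ↦ μ_∞(t(ψ))` is** — the honest binder `hμ` («the archimedean component of a Hecke character is
smooth along a smooth curve in `(L⊗ℝ)ˣ`», not in the tree); `μ_∞(u)` is constant along the curve and `μ_∞(t(0)) ≠ 0`. [cite: Rogawski1990, §8.2 (8.2.1) p. 123; §4.9 p. 55] -/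
theorem differentiableAt_archTau_archSingularCurve_of (hμ : DifferentiableAt ℝ (fun ψ => archHeckeValue L μ (archTauArg L (γH ψ))) 0) :
    DifferentiableAt ℝ (fun ψ => archTau L (γH ψ) μ) 0 := by
  have hfun : (fun ψ => archTau L (γH ψ) μ) =
      fun ψ => archHeckeValue L μ (archGammaTwo L (γH 0)) * (archHeckeValue L μ (archTauArg L (γH ψ)))⁻¹ := by
    funext ψ
    unfold archTau
    rw [archGammaTwo_archSingularCurveH_eq L z₀ c γH hγH ψ]
  rw [hfun]
  refine (differentiableAt_const _).mul (hμ.inv ?_)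
  exact archHeckeValue_ne_zero_of_isUnit L μ
    (isUnit_archTauArg_of_isUnit L (γH 0) (isUnit_eval_archCharpolyTwo_archSingularCurveH_zero L z₀ c γH hγH h02 h01))

include hγH hγG h02 h01 hherm hanis in
open scoped Classical in
/-- **Near `ψ = 0`, `Δ″_∞(γ_H(ψ), γ(ψ)) = τ_∞(ψ) · D(ψ) · Π_w κ_w(0)`** — the sign product is FROZEN at its `ψ = 0` value (★ B-p12
`eventually_prod_archKappaAt_archSingularCurve_eq`, ★ `archExplicitDelta_of_isArchNormPair`). [cite: Rogawski1990, §8.2 pp. 122–123; §14.6 p. 242] -/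
theorem eventually_archExplicitDelta_archSingularCurve_eq :
    ∀ᶠ ψ in 𝓝 (0 : ℝ), archExplicitDelta L (Matrix.diagonal α) (γH ψ) μ (γG ψ) =
      archTau L (γH ψ) μ * ((archWeylRatio L (γH ψ) : ℝ) : ℂ) *
        ((∏ w : {w : InfinitePlace L // IsComplex w}, archKappaAt L (Matrix.diagonal α) (γH 0) w (γG 0) : ℤ) : ℂ) := by
  filter_upwards [eventually_prod_archKappaAt_archSingularCurve_eq L α z₀ c γH γG hγH hγG h02 h01 hherm hanis] with ψ hψ
  rw [archExplicitDelta_of_isArchNormPair L (Matrix.diagonal α) (γH ψ) μ (isArchNormPair_archSingularCurve L α z₀ c γH γG hγH hγG ψ), hψ]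

include hγH hγG h02 h01 hherm hanis in
open scoped Classical in
/-- **`ψ ↦ Δ″_∞(γ_H(ψ), γ(ψ))` IS DIFFERENTIABLE AT `ψ = 0`** along the lifted singular curve, PROVIDED `ψ ↦ μ_∞(t(ψ))` is (binder `hμ`) — the transfer-factor
half of print's `∂∕∂ψ (τ(γ)D_G(γ)Φ^κ(γ,f))` at `ψ = 0` ((8.2.1)). [cite: Rogawski1990, §8.2 (8.2.1) p. 123; §14.6 p. 242] -/
theorem differentiableAt_archExplicitDelta_archSingularCurve_of (hμ : DifferentiableAt ℝ (fun ψ => archHeckeValue L μ (archTauArg L (γH ψ))) 0) :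
    DifferentiableAt ℝ (fun ψ => archExplicitDelta L (Matrix.diagonal α) (γH ψ) μ (γG ψ)) 0 := by
  have hEq : (fun ψ => archExplicitDelta L (Matrix.diagonal α) (γH ψ) μ (γG ψ)) =ᶠ[𝓝 (0 : ℝ)]
      fun ψ => archTau L (γH ψ) μ * ((archWeylRatio L (γH ψ) : ℝ) : ℂ) *
        ((∏ w : {w : InfinitePlace L // IsComplex w}, archKappaAt L (Matrix.diagonal α) (γH 0) w (γG 0) : ℤ) : ℂ) :=
    eventually_archExplicitDelta_archSingularCurve_eq L α z₀ c γH γG hγH hγG h02 h01 μ hherm hanis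
  refine (hEq.differentiableAt_iff).2 ?_
  refine ((differentiableAt_archTau_archSingularCurve_of L z₀ c γH hγH h02 h01 μ hμ).mul ?_).mul (differentiableAt_const _)
  exact Complex.ofRealCLM.differentiableAt.comp (0 : ℝ) (differentiableAt_archWeylRatio_archSingularCurve L z₀ c γH hγH h02 h01)

end Tau

end Literature.NumberTheory.Rogawski1990

end
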